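import Summits.CriticalPhenomena.PercolationContinuityZ3.Theorems.PercNearOneGluingNoHeavyLowerTailMajorityGluingTypeTableClasses
import HarnessLib

/-!
# The 94-type table of the abstract `(4,3)` programme — the set facts of LEMMA J and THEOREM BOTTOM
(lane prim-rate, constants-miner 1, gen 27; CLEAN-CERTIFICATES.md §3 (LEMMA B (iii)), §4 (profile identity), §5 (LEMMA J),
§8 ((S2)–(S5)); census/g24/tools/lemmaJ.py, lemmaJ2.py, propW3.py, propW5.py)

Support file for the closed crux `NoHeavyLowerTail` (stmt-CriticalPhenomena-4575), majority-gluing line; companion of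
`…MajorityGluingTypeTableClasses`.  Every «typewise set fact» that CLEAN-CERTIFICATES.md prints with the words
«machine-checked typewise» / «set-checked» / «all True (tools/propW5.py)» is here a `decide +kernel` theorem about
the generated table:

* the class census (K4 1, FAMILY 12, FACE′ 28, KK 42, `q_z ∈ KK`; `|CTRL_z| = 17`, `|J_z| = 11`, `|KS_w| = 41`,
  `|J2_w| = 3`) and the partition of the 79 non-inert types;
* LEMMA B (iii): `CTRL_z = {v_z cut, v₁ att, N ≤ 2} ⊔ (Q ∩ {v_z cut})`, `S_z ⊆ CTRL_z ⊔ J_z`, `s_z ∈ CTRL_z`;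
* LEMMA J: (J1) junk sits in hub triples avoiding any prescribed relay, (J2) `KK ⊆ ⋃ u_{0ab}`, (J3) `π_{z¬y} = ρ_z^{0zy}
  ⊆ {s_z, t_y} ∪ FACE′ ∪ KK` with `FACE′ ∩ π ⊆ CTRL_z`, (J5) `J_z ⊆ KK`, (J6) `q_w ∉ π_{z¬y}`, (J7);
* the PROFILE IDENTITY `ρ_z^{1234} = 1[S_z] + 1[T_z]` (ISO₄ in the form `U₄^{c₄} ≤ M^{4−c₄}Π(S_z + T_z)`);
* THEOREM BOTTOM's (S2)–(S5) for every dominant relay `w`;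
* and the same inclusions in the `combo ≤ 0` / `combo = 0` shape that the law-level engine (`cc_bound`, `cc_eq` of
  `…TypeTableCertificates`) integrates against a law: `x(CTRL_w) = B_w + T_w − E`, `K ≤ Σ u_{0ab}`,
  `π_{z¬y} ≤ x(CTRL_z) + x(t_y) + x(KK ∩ π)`, (S2)–(S5), budget events.

No definitions, no sorries.  [cite: VandenbergHaggstromKahn2005, Thm. 1.3 (p. 6)]
-/

namespace Summit.CriticalPhenomena.PercolationContinuityZ3.Theorems

namespace HubOnly
namespace TypeTable

open DType

/-! ### Class sizes and the partition of the non-inert types -/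

/-- `K4` (1) ⊔ FAMILY (12) ⊔ FACE′ (28) ⊔ (KK ∖ FAMILY) (38) = the 79 non-inert types; `KK` has 42 types, of which
the four `q_z` are family; the inert types lie in no class. -/
theorem classes_card :
    (allTypes.filter fun τ => τ.isK4).length = 1 ∧ (allTypes.filter fun τ => τ.family).length = 12 ∧
    (allTypes.filter fun τ => τ.isFACE).length = 28 ∧ (allTypes.filter fun τ => τ.isKK).length = 42 ∧
    (allTypes.filter fun τ => τ.family && τ.isKK).length = 4 ∧
    (∀ τ ∈ allTypes, τ.inert = false →
      (τ.isK4.toNat + τ.family.toNat + τ.isFACE.toNat + τ.isKK.toNat - (τ.family && τ.isKK).toNat = 1)) ∧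
    (∀ τ ∈ allTypes, τ.inert = true → (τ.isK4 || τ.family || τ.isFACE || τ.isKK) = false) := by decide +kernel

/-- Each family predicate singles out exactly one type per relay; `q_z ∈ KK`, `s_z ∈ S_z ∩ CTRL_z`, `t_z ∈ T_z`. -/
theorem family_card : ∀ z ∈ [1, 2, 3, 4],
    (allTypes.filter fun τ => τ.isLs z).length = 1 ∧ (allTypes.filter fun τ => τ.isLt z).length = 1 ∧
    (allTypes.filter fun τ => τ.isLq z).length = 1 ∧
    (∀ τ ∈ allTypes, (τ.isLq z = true → τ.isKK = true) ∧ (τ.isLs z = true → τ.isS z = true ∧ τ.ctrl z = true) ∧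
      (τ.isLt z = true → τ.isT z = true)) := by decide +kernel

/-- `|CTRL_z| = 17`, `|J_z| = 11`, `|KS_w| = 41`, `|J2_w| = 3` for every relay. -/
theorem junk_card : ∀ z ∈ [1, 2, 3, 4],
    (allTypes.filter fun τ => τ.ctrl z).length = 17 ∧ (allTypes.filter fun τ => τ.junk z).length = 11 ∧
    (allTypes.filter fun τ => τ.isKS z).length = 41 ∧ (allTypes.filter fun τ => τ.isJ2 z).length = 3 := by
  decide +kernel

/-! ### LEMMA B's control sets and the junk (CLEAN-CERTIFICATES §3) -/

/-- `CTRL_z` (`z = 2,3,4`) is exactly the union of the two negative LEMMA-B events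
`{v_z cut, v₁ att, N ≤ 2} ⊔ (Q ∩ {v_z cut})`, and `CTRL₁ = Q`; `CTRL_z` is disjoint from `T_z`. -/
theorem ctrl_eq : ∀ τ ∈ allTypes,
    (∀ z ∈ [2, 3, 4], τ.ctrl z = ((τ.cut z && τ.att 1 && decide (τ.ncut ≤ 2)) || (τ.eZ == -1 && τ.cut z)) ∧
      ((τ.cut z && τ.att 1 && decide (τ.ncut ≤ 2)) && (τ.eZ == -1 && τ.cut z)) = false) ∧
    τ.ctrl 1 = (τ.eZ == -1) ∧ (∀ z ∈ [1, 2, 3, 4], (τ.ctrl z && τ.isT z) = false) := by decide +kernel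

/-- LEMMA B (iii): `S_z ⊆ CTRL_z ⊔ J_z` (so `S_z ≤ (T_z − E) + j_z` under the budget), `J_z = S_z ∖ CTRL_z`, and
(J5) every junk type has at least two cut blocks (`J_z ⊆ KK`), hence `N ≥ 3`… and lies in some hub triple. -/
theorem junk_facts : ∀ τ ∈ allTypes, ∀ z ∈ [1, 2, 3, 4],
    (τ.isS z = true → (τ.ctrl z || τ.junk z) = true) ∧ τ.junk z = (τ.isS z && !τ.ctrl z) ∧
    (τ.junk z = true → τ.isKK = true ∧ 3 ≤ τ.ncut ∧ τ.inHubTriple = true) := by decide +kernel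

/-- **(J1)** Every junk type of relay `z` lies, for every prescribed relay `w ≠ z`, in a hub triple `u_{0zy}` with
`y ∉ {z, w}`. -/
theorem J1 : ∀ τ ∈ allTypes, ∀ z ∈ [1, 2, 3, 4], ∀ w ∈ [1, 2, 3, 4], z ≠ w → τ.junk z = true →
    ([1, 2, 3, 4].any fun y => !(y == z) && !(y == w) && τ.uB [0, z, y]) = true := by decide +kernel

/-- **(J2)** Every type with at least two cut blocks lies in some hub triple `u_{0ab}`. -/
theorem J2 : ∀ τ ∈ allTypes, τ.isKK = true → τ.inHubTriple = true := by decide +kernel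

/-- **(J3)** `π_{z¬y} = ρ_z^{0zy}`, and `π_{z¬y} ⊆ {s_z, t_y} ∪ FACE′ ∪ KK` with (J3′) `FACE′ ∩ π_{z¬y} ⊆ CTRL_z`;
**(J6)** `q_w ∉ π_{z¬y}` for `z, y ≠ w`. -/
theorem J3 : ∀ τ ∈ allTypes, ∀ z ∈ [1, 2, 3, 4], ∀ y ∈ [1, 2, 3, 4], z ≠ y →
    τ.piSupp z y = τ.rho [0, z, y] z ∧
    (τ.piSupp z y = true → (τ.isLs z || τ.isLt y || τ.isFACE || τ.isKK) = true) ∧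
    (τ.piSupp z y = true → τ.isFACE = true → τ.ctrl z = true) ∧
    (∀ w ∈ [1, 2, 3, 4], w ≠ z → w ≠ y → τ.isLq w = true → τ.piSupp z y = false) := by decide +kernel

/-- **(J7)** `S_z ∩ {one cut block} = {s_z} ∪ (FACE′ types in CTRL_z)`. -/
theorem J7 : ∀ τ ∈ allTypes, ∀ z ∈ [1, 2, 3, 4], τ.isS z = true → τ.ncutBlocks = 1 →
    (τ.isLs z || (τ.isFACE && τ.ctrl z)) = true := by decide +kernel

/-- **Profile identity** (PROPOSITION W₃): the support of `v_z` in the four-relay isolation row is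
`ρ_z^{1234} = 1[S_z] + 1[T_z]` typewise — so ISO₄ reads `U₄^{c₄} ≤ M^{4−c₄}·Π_z (S_z + T_z)` in scale-free form. -/
theorem profile_identity : ∀ τ ∈ allTypes, ∀ z ∈ [1, 2, 3, 4],
    ind (τ.rho [1, 2, 3, 4] z) = ind (τ.isS z) + ind (τ.isT z) := by decide +kernel

/-! ### THEOREM BOTTOM's set facts for a dominant relay `w` (CLEAN-CERTIFICATES §8, (S2)–(S5)) -/

/-- **(S2)** `π_{a¬b} ⊆ CTRL_a ∪ {t_b} ∪ KS_w` for all `a ≠ b`, both `≠ w`. -/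
theorem S2 : ∀ τ ∈ allTypes, ∀ w ∈ [1, 2, 3, 4], ∀ a ∈ [1, 2, 3, 4], ∀ b ∈ [1, 2, 3, 4],
    a ≠ b → a ≠ w → b ≠ w → τ.piSupp a b = true → (τ.ctrl a || τ.isLt b || τ.isKS w) = true := by decide +kernel

/-- **(S3)** `KS_w ⊆ {types in a w-free hub triple} ∪ ⋃_{z≠w} CTRL_z ∪ J2_w`, and (S3b) each `τ ∈ J2_w` lies in the
relay triple `u_{wzy}` for every `z` of its pair block (`y` the attached relay) — stated as: for every cut `z ≠ w` and
attached `y ≠ w`, `u_{w z y}` holds. -/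
theorem S3 : ∀ τ ∈ allTypes, ∀ w ∈ [1, 2, 3, 4], (τ.isKS w = true →
      (τ.inWfreeHubTriple w || ([1, 2, 3, 4].any fun z => !(z == w) && τ.ctrl z) || τ.isJ2 w) = true) ∧
    (τ.isJ2 w = true → ∀ z ∈ [1, 2, 3, 4], ∀ y ∈ [1, 2, 3, 4], z ≠ w → y ≠ w → τ.cut z = true → τ.att y = true →
      τ.uB [w, z, y] = true) := by decide +kernel

/-- `u_S` does not depend on the order in which `S` is listed (the relay triples as used in (S3b) and (S4)). -/
theorem uB_perm3 : ∀ τ ∈ allTypes, ∀ a ∈ [0, 1, 2, 3, 4], ∀ b ∈ [0, 1, 2, 3, 4], ∀ c ∈ [0, 1, 2, 3, 4],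
    τ.uB [a, b, c] = τ.uB [b, a, c] ∧ τ.uB [a, b, c] = τ.uB [a, c, b] := by decide +kernel

/-- **(S4)** For the relay triple `S = {w, a, b}` (`a, b ≠ w` distinct): `ρ_a^S ⊆ π_{a¬b} ∪ T_a ∪ CTRL_b`. -/
theorem S4 : ∀ τ ∈ allTypes, ∀ w ∈ [1, 2, 3, 4], ∀ a ∈ [1, 2, 3, 4], ∀ b ∈ [1, 2, 3, 4],
    a ≠ b → a ≠ w → b ≠ w → τ.rho [w, a, b] a = true → (τ.piSupp a b || τ.isT a || τ.ctrl b) = true := by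
  decide +kernel

/-- **(S5)** `J_z ⊆ KS_w` for `z ≠ w`, and `q_w ∉ KS_w`. -/
theorem S5 : ∀ τ ∈ allTypes, ∀ w ∈ [1, 2, 3, 4],
    (∀ z ∈ [1, 2, 3, 4], z ≠ w → τ.junk z = true → τ.isKS w = true) ∧ (τ.isLq w = true → τ.isKS w = false) := by
  decide +kernel

/-- The hub point's support is bounded by a budget event and the supports are budget events too:
`ρ₀^{0ab} ⊆ {v_a cut}`, `π_{a¬b} ⊆ {v_a cut}` (so `≤ δ_a/δ₁ ≤ 1` in scale-free units under the budget `B_a`). -/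
theorem supports_le_cut : ∀ τ ∈ allTypes, ∀ a ∈ [1, 2, 3, 4], ∀ b ∈ [1, 2, 3, 4], a ≠ b →
    (τ.rho [0, a, b] 0 = true → τ.cut a = true ∧ τ.cut b = true) ∧ (τ.piSupp a b = true → τ.cut a = true) := by
  decide +kernel

/-! ### The same inclusions in the `combo ≤ 0` / `combo = 0` shape (consumed by `cc_bound` / `cc_eq` at law level) -/

/-- LEMMA B with the control sets: `e = B_w + 1[T_w] − 1[CTRL_w]` (`w = 2,3,4`) and `e = 1[T₁] − 1[CTRL₁]`; hence
`x(CTRL_w) = B_w(x) + T_w(x) − E(x) ≤ T_w(x) − E(x)` under the budget. -/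
theorem ctrl_combo : ∀ τ ∈ allTypes,
    (∀ w ∈ [2, 3, 4], combo [(1, eZ), (-1, fun τ => τ.bud w), (-1, fun τ => ind (τ.isT w)),
      (1, fun τ => ind (τ.ctrl w))] τ = 0) ∧
    combo [(1, eZ), (-1, fun τ => ind (τ.isT 1)), (1, fun τ => ind (τ.ctrl 1))] τ = 0 := by decide +kernel

/-- `1[S_z] ≤ 1[CTRL_z] + 1[J_z]` (LEMMA B (iii): `S_z ≤ T_z − E + j_z`). -/
theorem S_le_ctrl_junk_combo : ∀ τ ∈ allTypes, ∀ z ∈ [1, 2, 3, 4],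
    combo [(1, fun τ => ind (τ.isS z)), (-1, fun τ => ind (τ.ctrl z)), (-1, fun τ => ind (τ.junk z))] τ ≤ 0 := by
  decide +kernel

/-- (J2) as `1[KK] ≤ Σ_{a<b} u_{0ab}`: `K ≤ Σ_{pairs} u_{0ab}(x)`. -/
theorem KK_le_hubTriples_combo : ∀ τ ∈ allTypes,
    combo [(1, fun τ => ind τ.isKK), (-1, fun τ => τ.uZ [0, 1, 2]), (-1, fun τ => τ.uZ [0, 1, 3]),
      (-1, fun τ => τ.uZ [0, 1, 4]), (-1, fun τ => τ.uZ [0, 2, 3]), (-1, fun τ => τ.uZ [0, 2, 4]),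
      (-1, fun τ => τ.uZ [0, 3, 4])] τ ≤ 0 := by decide +kernel

/-- (J3) as `1[π_{z¬y}] ≤ 1[CTRL_z] + 1[t_y] + 1[KK ∩ π_{z¬y}]`: the support bound
`π_{z¬y}(x) ≤ x(CTRL_z) + x(t_y) + x(KK ∩ π_{z¬y}) ≤ (T_z − E) + T_y + K`. -/
theorem piSupp_combo : ∀ τ ∈ allTypes, ∀ z ∈ [1, 2, 3, 4], ∀ y ∈ [1, 2, 3, 4], z ≠ y →
    combo [(1, fun τ => ind (τ.piSupp z y)), (-1, fun τ => ind (τ.ctrl z)), (-1, fun τ => ind (τ.isLt y)),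
      (-1, fun τ => ind (τ.isKK && τ.piSupp z y))] τ ≤ 0 ∧
    combo [(1, fun τ => ind (τ.isLt y)), (-1, fun τ => ind (τ.isT y))] τ ≤ 0 := by decide +kernel

/-- (S2) as `1[π_{a¬b}] ≤ 1[CTRL_a] + 1[t_b] + 1[KS_w]` (`a ≠ b`, both `≠ w`). -/
theorem S2_combo : ∀ τ ∈ allTypes, ∀ w ∈ [1, 2, 3, 4], ∀ a ∈ [1, 2, 3, 4], ∀ b ∈ [1, 2, 3, 4],
    a ≠ b → a ≠ w → b ≠ w →
    combo [(1, fun τ => ind (τ.piSupp a b)), (-1, fun τ => ind (τ.ctrl a)), (-1, fun τ => ind (τ.isLt b)),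
      (-1, fun τ => ind (τ.isKS w))] τ ≤ 0 := by decide +kernel

/-- (S3) as `1[KS_w] ≤ Σ_{a<b, ≠w} u_{0ab} + Σ_{z≠w} 1[CTRL_z] + 1[J2_w]`, for each `w` (the `w`-free pairs listed). -/
theorem S3_combo : ∀ τ ∈ allTypes,
    combo [(1, fun τ => ind (τ.isKS 1)), (-1, fun τ => τ.uZ [0, 2, 3]), (-1, fun τ => τ.uZ [0, 2, 4]),
      (-1, fun τ => τ.uZ [0, 3, 4]), (-1, fun τ => ind (τ.ctrl 2)), (-1, fun τ => ind (τ.ctrl 3)),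
      (-1, fun τ => ind (τ.ctrl 4)), (-1, fun τ => ind (τ.isJ2 1))] τ ≤ 0 ∧
    combo [(1, fun τ => ind (τ.isKS 2)), (-1, fun τ => τ.uZ [0, 1, 3]), (-1, fun τ => τ.uZ [0, 1, 4]),
      (-1, fun τ => τ.uZ [0, 3, 4]), (-1, fun τ => ind (τ.ctrl 1)), (-1, fun τ => ind (τ.ctrl 3)),
      (-1, fun τ => ind (τ.ctrl 4)), (-1, fun τ => ind (τ.isJ2 2))] τ ≤ 0 ∧
    combo [(1, fun τ => ind (τ.isKS 3)), (-1, fun τ => τ.uZ [0, 1, 2]), (-1, fun τ => τ.uZ [0, 1, 4]),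
      (-1, fun τ => τ.uZ [0, 2, 4]), (-1, fun τ => ind (τ.ctrl 1)), (-1, fun τ => ind (τ.ctrl 2)),
      (-1, fun τ => ind (τ.ctrl 4)), (-1, fun τ => ind (τ.isJ2 3))] τ ≤ 0 ∧
    combo [(1, fun τ => ind (τ.isKS 4)), (-1, fun τ => τ.uZ [0, 1, 2]), (-1, fun τ => τ.uZ [0, 1, 3]),
      (-1, fun τ => τ.uZ [0, 2, 3]), (-1, fun τ => ind (τ.ctrl 1)), (-1, fun τ => ind (τ.ctrl 2)),
      (-1, fun τ => ind (τ.ctrl 3)), (-1, fun τ => ind (τ.isJ2 4))] τ ≤ 0 := by decide +kernel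

/-- (S3b) as `1[J2_w] ≤ Σ_{relay triples ∋ w} u_S`: every `J2_w` type is capped by a relay triple through `v_w` (the triples
are listed as `[w, a, b]`, `a < b` the other relays; `u_S` does not depend on the order, `uB_perm3`). -/
theorem J2_le_relayTriples_combo : ∀ τ ∈ allTypes,
    combo [(1, fun τ => ind (τ.isJ2 1)), (-1, fun τ => τ.uZ [1, 2, 3]), (-1, fun τ => τ.uZ [1, 2, 4]),
      (-1, fun τ => τ.uZ [1, 3, 4])] τ ≤ 0 ∧
    combo [(1, fun τ => ind (τ.isJ2 2)), (-1, fun τ => τ.uZ [2, 1, 3]), (-1, fun τ => τ.uZ [2, 1, 4]),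
      (-1, fun τ => τ.uZ [2, 3, 4])] τ ≤ 0 ∧
    combo [(1, fun τ => ind (τ.isJ2 3)), (-1, fun τ => τ.uZ [3, 1, 2]), (-1, fun τ => τ.uZ [3, 1, 4]),
      (-1, fun τ => τ.uZ [3, 2, 4])] τ ≤ 0 ∧
    combo [(1, fun τ => ind (τ.isJ2 4)), (-1, fun τ => τ.uZ [4, 1, 2]), (-1, fun τ => τ.uZ [4, 1, 3]),
      (-1, fun τ => τ.uZ [4, 2, 3])] τ ≤ 0 := by decide +kernel

/-- (S4) as `ρ_a^{wab} ≤ 1[π_{a¬b}] + 1[T_a] + 1[CTRL_b]` and (S5) as `1[J_z] ≤ 1[KS_w]`. -/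
theorem S4_S5_combo : ∀ τ ∈ allTypes, ∀ w ∈ [1, 2, 3, 4], ∀ a ∈ [1, 2, 3, 4], ∀ b ∈ [1, 2, 3, 4],
    a ≠ b → a ≠ w → b ≠ w →
    combo [(1, fun τ => ind (τ.rho [w, a, b] a)), (-1, fun τ => ind (τ.piSupp a b)), (-1, fun τ => ind (τ.isT a)),
      (-1, fun τ => ind (τ.ctrl b))] τ ≤ 0 ∧
    combo [(1, fun τ => ind (τ.junk a)), (-1, fun τ => ind (τ.isKS w))] τ ≤ 0 := by decide +kernel

/-- Budget events: `ρ₀^{0ab} ≤ 1[v_a cut]`, `1[π_{a¬b}] ≤ 1[v_a cut]`, `1[T_z] + 1[CTRL_z] ≤ …`; and the scale-free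
normalisation event `1[v₁ cut]` dominates `1[v_a cut] − B_a` trivially (`B_a = cut_a − cut₁`). -/
theorem budget_combo : ∀ τ ∈ allTypes, ∀ a ∈ [1, 2, 3, 4], ∀ b ∈ [1, 2, 3, 4], a ≠ b →
    combo [(1, fun τ => ind (τ.rho [0, a, b] 0)), (-1, fun τ => τ.cutZ a)] τ ≤ 0 ∧
    combo [(1, fun τ => ind (τ.piSupp a b)), (-1, fun τ => τ.cutZ a)] τ ≤ 0 ∧
    combo [(1, fun τ => τ.cutZ a), (-1, fun τ => τ.cutZ 1), (-1, fun τ => τ.bud a)] τ ≤ 0 := by decide +kernel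

/-- More budget events: all-cut `⊆ {v₁ cut}`; the relay support `ρ_w^{wab}` of a relay triple is a non-inert event,
hence `≤ Σ_z 1[v_z cut]` (so `≤ 4` in scale-free units); the junk is `KK`-mass: `1[J_w] ≤ 1[KK]`. -/
theorem budget_combo' : ∀ τ ∈ allTypes,
    combo [(1, fun τ => ind τ.allCut), (-1, fun τ => τ.cutZ 1)] τ ≤ 0 ∧
    (∀ w ∈ [1, 2, 3, 4], ∀ a ∈ [1, 2, 3, 4], ∀ b ∈ [1, 2, 3, 4], a ≠ b → a ≠ w → b ≠ w →
      combo [(1, fun τ => ind (τ.rho [w, a, b] w)), (-1, fun τ => τ.cutZ 1), (-1, fun τ => τ.cutZ 2),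
        (-1, fun τ => τ.cutZ 3), (-1, fun τ => τ.cutZ 4)] τ ≤ 0) ∧
    (∀ w ∈ [1, 2, 3, 4], combo [(1, fun τ => ind (τ.junk w)), (-1, fun τ => ind τ.isKK)] τ ≤ 0) := by
  decide +kernel

/-- The support indicator `ρ_t^S` does not depend on the order in which the triple `S` is listed. -/
theorem rho_perm3 : ∀ τ ∈ allTypes, ∀ a ∈ [0, 1, 2, 3, 4], ∀ b ∈ [0, 1, 2, 3, 4], ∀ c ∈ [0, 1, 2, 3, 4],
    (∀ t : ℕ, τ.rho [a, b, c] t = τ.rho [b, a, c] t) ∧ (∀ t : ℕ, τ.rho [a, b, c] t = τ.rho [a, c, b] t) := by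
  intro τ _ a _ b _ c _
  constructor <;> intro t <;> simp only [DType.rho, List.all_cons, List.all_nil, Bool.and_true] <;>
    cases (a == t || τ.sep t a) <;> cases (b == t || τ.sep t b) <;> cases (c == t || τ.sep t c) <;> rfl

end TypeTable
end HubOnly

end Summit.CriticalPhenomena.PercolationContinuityZ3.Theorems
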